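import Summits.HubbardSuperconductivity.HubbardSuperconductivity.Theorems.WidthHaldaneDefs
import Literature.MathematicalPhysics.QuantumLattice.HubbardTorusFluxBlochBound

/-!
# `WidthHaldaneBridge` (stmt-HubbardSuperconductivity-16311), negative side: the void region of its
# load-bearing hypothesis `UniformThermo`

The crux `WidthHaldaneBridge` is the implication `UniformThermo U δ d₀ k₀ M₁ L₀ → ∃ Ξ A R M₂ L₁,
HaldaneLaw …` for EVERY `U > 0`, `δ ∈ (0, 3/10)` and ALL data `(d₀ > 0, k₀, M₁, L₀)`
(`Theorems.WidthHaldane.widthHaldaneBridge_iff`). Its only load-bearing hypothesis is the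
width-uniform thermodynamics `UniformThermo` (the matrix of the sibling crux
`WidthUniformThermodynamics`, stmt-16312). This file proves, sorry-free, WHERE that hypothesis is
void — so that provers, planners and the disprover agree on the only data region in which the
Bridge has content:

* `tubeStiffness_diag_le_four` — the a-priori Bloch / Lieb–Schultz–Mattis ceiling on the twist
  stiffness per site of the SQUARE tube read at the fixed twist `θ₀ = π/3`:
  `ρ̃_{L,L}(U,δ) ≤ 4` for every `U, δ` and every side `L ≥ 1` (diagonal instance `M = L` of the
  crux's hypothesis, carrier `FermionTorus 2 L`, labelling `x ↦ (x₀, x₁)`; it IS the flux envelope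
  of `Literature…fluxEnergy` — `tubeEnergy_diag_eq_fluxEnergy` — and the bound is the Literature
  theorem `fluxEnergy_le_fluxEnergy_zero_add_two_mul_sq`, `E^T(θ) ≤ E^T(0) + 2θ²`).
* `uniformThermo_false_of_four_lt` — hence `UniformThermo U δ d₀ k₀ M₁ L₀` is FALSE whenever
  `d₀ > 4` (instance `L = M = 2(M₁ + L₀ + 2)`): on that data region the Bridge is vacuous, and any
  use of the Bridge (e.g. `WidthHaldane.closes`, `SeamInduction.closes`) necessarily runs at
  `d₀ ≤ 4`.
* `uniformThermo_false_of_nonpos` — and it is false whenever `k₀ ≤ 0` (the compressibility clause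
  `0 < ẽ″ ≤ k₀`).
* `not_widthHaldaneBridge_imp` — consequently a refutation of the Bridge can only come from data with
  `0 < d₀ ≤ 4`, `0 < k₀` at which `UniformThermo` HOLDS, i.e. it must CERTIFY the width-uniform
  thermodynamics of the pure Hubbard tubes at some `(U, δ)` of the window (the content of
  stmt-16312): the negation of the crux is at least as strong as its sibling crux.

Sources: D. Bohm, Phys. Rev. 75 (1949) 502; H. Watanabe, J. Stat. Phys. 177 (2019) 717 §2.2.1,
§4.1 (the twist costs `O(L_y/L_x)`); Y. Tada, T. Koma, J. Stat. Phys. 165 (2016) 455 §4;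
D. J. Scalapino, S. R. White, S. C. Zhang, PRB 47 (1993) 7995 §II (stiffness from the flux
envelope). No definitions are introduced.
-/

noncomputable section

namespace Summit.HubbardSuperconductivity.HubbardSuperconductivity.Theorems.WidthHaldaneBridge.Negative

set_option linter.dupNamespace false -- summit = problem name (single-conjunct summit), D-0017

open scoped BigOperators Classical Matrix ComplexConjugate
open Matrix Literature.MathematicalPhysics.QuantumLattice Literature.Probability.LatticeModels
open Summit.HubbardSuperconductivity.HubbardSuperconductivity.Theorems.WidthHaldane
open Summit.HubbardSuperconductivity.HubbardSuperconductivity.Theses.WidthHaldane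
  (WidthHaldaneBridge WidthUniformThermodynamics)

variable {L : ℕ} [NeZero L]

/-! ### The diagonal instance `M = L` on the carrier `FermionTorus 2 L` -/

/-- Hubbard Hamiltonians of two graphs with the same adjacency agree (whatever the decidability
instances). [folklore] -/
theorem hamiltonian_congr_adj {Λ : Type} [LinearOrder Λ] [Fintype Λ] (G₁ G₂ : SimpleGraph Λ)
    (i₁ : DecidableRel G₁.Adj) (i₂ : DecidableRel G₂.Adj) (h : ∀ x y, G₁.Adj x y ↔ G₂.Adj x y)
    (t U : ℝ) : @hamiltonian _ _ _ G₁ i₁ t U = @hamiltonian _ _ _ G₂ i₂ t U := by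
  have hG : G₁ = G₂ := by ext x y; exact h x y
  subst hG
  congr

/-- On the square carrier `FermionTorus 2 L` with the coordinate labelling `x ↦ (x₀, x₁)`, the tube
Hamiltonian `tubeH0 L L` IS the Hubbard torus `hubbardTorus 2 L 1 U` (same adjacency).
[folklore] -/
theorem tubeH0_diag_eq_hubbardTorus (U : ℝ) (e : FermionTorus 2 L ≃ ZMod L × ZMod L)
    (he : ∀ x, e x = (FermionTorus.toTorusSite x 0, FermionTorus.toTorusSite x 1)) :
    tubeH0 L L (FermionTorus 2 L) e U = hubbardTorus 2 L 1 U := by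
  have hinj : ∀ u v : FermionTorus 2 L,
      FermionTorus.toTorusSite u = FermionTorus.toTorusSite v ↔ u = v := fun u v =>
    (FermionTorus.equivTorusSite (d := 2) (L := L)).injective.eq_iff
  have hsymm : ∀ (v : FermionTorus 2 L) (p : ZMod L × ZMod L),
      v = e.symm p ↔ FermionTorus.toTorusSite v = ![p.1, p.2] := by
    intro v p
    rw [Equiv.eq_symm_apply, he, Prod.ext_iff, funext_iff, Fin.forall_fin_two]
    simp
  have hS0 : ∀ t : Fin 2 → ZMod L, t + Pi.single 0 1 = ![t 0 + 1, t 1] := fun t => by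
    funext i; fin_cases i <;> simp
  have hS1 : ∀ t : Fin 2 → ZMod L, t + Pi.single 1 1 = ![t 0, t 1 + 1] := fun t => by
    funext i; fin_cases i <;> simp
  rw [tubeH0, hubbardTorus]
  refine hamiltonian_congr_adj _ _ _ _ (fun x y => ?_) 1 U
  simp only [SimpleGraph.fromRel_adj, fermionTorusGraph_adj, torusGraph_adj_iff, Fin.exists_fin_two,
    hsymm, he, hS0, hS1, ne_eq, hinj]

/-- On the square carrier the crux's seam twist `tubeTwist L L` IS `Literature…seamTwist L`
(the `b = true / false` summands are the two conjugate seam terms). [folklore] -/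
theorem tubeTwist_diag_eq_seamTwist (θ : ℝ) (e : FermionTorus 2 L ≃ ZMod L × ZMod L)
    (hes : ∀ p : ZMod L × ZMod L, e.symm p = FermionTorus.ofTorusSite ![p.1, p.2]) :
    tubeTwist L L (FermionTorus 2 L) e θ = seamTwist L θ := by
  rw [tubeTwist, seamTwist_eq]
  refine Finset.sum_congr rfl fun y _ => Finset.sum_congr rfl fun σ _ => ?_
  rw [Fintype.sum_bool]
  simp only [hes, if_true, Bool.false_eq_true, if_false, one_mul, neg_mul]

/-- The filling of the square tube is the filling of the flux envelope: `N_{L,L} = 2⌊(1-δ)L²/2⌋`.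
[folklore] -/
theorem tubeFilling_diag (L : ℕ) (δ : ℝ) : tubeFilling L L δ = 2 * ⌊(1 - δ) * (L : ℝ) ^ 2 / 2⌋₊ := by
  rw [tubeFilling, sq]

/-- **The diagonal twisted sector energy is the Literature flux envelope**:
`E_{L,L}(U; θ, N_{L,L}(δ)) = E^T_L(U, δ; θ)` on `FermionTorus 2 L` with the coordinate labelling.
[folklore] -/
theorem tubeEnergy_diag_eq_fluxEnergy (U δ θ : ℝ) (e : FermionTorus 2 L ≃ ZMod L × ZMod L)
    (he : ∀ x, e x = (FermionTorus.toTorusSite x 0, FermionTorus.toTorusSite x 1))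
    (hes : ∀ p : ZMod L × ZMod L, e.symm p = FermionTorus.ofTorusSite ![p.1, p.2]) :
    tubeEnergy L L (FermionTorus 2 L) e U θ (tubeFilling L L δ) = fluxEnergy L U δ θ := by
  rw [tubeEnergy, fluxEnergy_eq, hubbardTorusFlux_eq, tubeH0_diag_eq_hubbardTorus U e he,
    tubeTwist_diag_eq_seamTwist θ e hes, tubeFilling_diag]

/-! ### The a-priori stiffness ceiling and the void data region -/

/-- **Bloch ceiling on the diagonal twist stiffness**: `ρ̃_{L,L}(U,δ) ≤ 4` for every `U, δ`, every
side `L ≥ 1` (coordinate labelling of `FermionTorus 2 L`). From `E^T(π/3) ≤ E^T(0) + 2(π/3)²`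
(`fluxEnergy_le_fluxEnergy_zero_add_two_mul_sq`) and `ρ̃ = 2L[E(π/3) − E(0)]/((π/3)² L)`.
[cite: Watanabe2019, §2.2.3 and §4.1] -/
theorem tubeStiffness_diag_le_four (U δ : ℝ) (e : FermionTorus 2 L ≃ ZMod L × ZMod L)
    (he : ∀ x, e x = (FermionTorus.toTorusSite x 0, FermionTorus.toTorusSite x 1))
    (hes : ∀ p : ZMod L × ZMod L, e.symm p = FermionTorus.ofTorusSite ![p.1, p.2]) :
    tubeStiffness L L (FermionTorus 2 L) e U δ ≤ 4 := by
  rw [tubeStiffness_eq, tubeEnergy_diag_eq_fluxEnergy U δ _ e he hes,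
    tubeEnergy_diag_eq_fluxEnergy U δ _ e he hes]
  have hB := fluxEnergy_le_fluxEnergy_zero_add_two_mul_sq (L := L) U δ (Real.pi / 3)
  have hL : (0 : ℝ) < L := Nat.cast_pos.2 (NeZero.pos L)
  have hpi : (0 : ℝ) < (Real.pi / 3) ^ 2 := by positivity
  rw [div_le_iff₀ (by positivity)]
  nlinarith

/-- The coordinate labelling of the square fermionic torus exists (it is
`equivTorusSite.trans (finTwoArrowEquiv _)`). [folklore] -/
theorem exists_diagLabel (L : ℕ) [NeZero L] :
    ∃ e : FermionTorus 2 L ≃ ZMod L × ZMod L,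
      (∀ x, e x = (FermionTorus.toTorusSite x 0, FermionTorus.toTorusSite x 1)) ∧
        ∀ p : ZMod L × ZMod L, e.symm p = FermionTorus.ofTorusSite ![p.1, p.2] :=
  ⟨FermionTorus.equivTorusSite.trans (finTwoArrowEquiv _), fun _ => rfl, fun _ => rfl⟩

/-- **`UniformThermo` is void above the Bloch ceiling**: for `d₀ > 4` the hypothesis of
`WidthHaldaneBridge` fails for every `U, δ, k₀, M₁, L₀` (read it on the square tube of even side
`2(M₁ + L₀ + 2)`). Any proof or use of the Bridge may assume `d₀ ≤ 4`. [folklore] -/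
theorem uniformThermo_false_of_four_lt {U δ d₀ k₀ : ℝ} {M₁ L₀ : ℕ} (hd : 4 < d₀) :
    ¬ UniformThermo U δ d₀ k₀ M₁ L₀ := by
  intro h
  obtain ⟨e, he, hes⟩ := exists_diagLabel (2 * (M₁ + L₀ + 2))
  haveI : NeZero (2 * (M₁ + L₀ + 2)) := ⟨by omega⟩
  obtain ⟨h1, -, -⟩ := h (2 * (M₁ + L₀ + 2)) (2 * (M₁ + L₀ + 2)) (even_two_mul _) (even_two_mul _)
    (by omega) le_rfl (by omega) (FermionTorus 2 (2 * (M₁ + L₀ + 2))) e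
  have h4 := tubeStiffness_diag_le_four U δ e he hes
  linarith

/-- **`UniformThermo` is void for `k₀ ≤ 0`** (the clause `0 < ẽ″_{L,M} ≤ k₀` at any admissible
tube forces `0 < k₀`). [folklore] -/
theorem uniformThermo_false_of_nonpos {U δ d₀ k₀ : ℝ} {M₁ L₀ : ℕ} (hk : k₀ ≤ 0) :
    ¬ UniformThermo U δ d₀ k₀ M₁ L₀ := by
  intro h
  obtain ⟨e, -, -⟩ := exists_diagLabel (2 * (M₁ + L₀ + 2))
  haveI : NeZero (2 * (M₁ + L₀ + 2)) := ⟨by omega⟩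
  obtain ⟨-, h2, h3⟩ := h (2 * (M₁ + L₀ + 2)) (2 * (M₁ + L₀ + 2)) (even_two_mul _) (even_two_mul _)
    (by omega) le_rfl (by omega) (FermionTorus 2 (2 * (M₁ + L₀ + 2))) e
  linarith

/-- **What a refutation of the Bridge must certify.** If `WidthHaldaneBridge` is false, then at some
`U > 0`, `δ ∈ (0, 3/10)` the pure Hubbard tubes DO have width-uniform thermodynamics with data in
the non-void region `0 < d₀ ≤ 4`, `0 < k₀` — i.e. the negation of the crux contains the sibling
crux `WidthUniformThermodynamics` (stmt-16312) with calibrated constants. [folklore] -/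
theorem not_widthHaldaneBridge_imp (h : ¬ WidthHaldaneBridge) :
    ∃ U : ℝ, 0 < U ∧ ∃ δ ∈ Set.Ioo (0 : ℝ) (3 / 10), ∃ d₀ : ℝ, 0 < d₀ ∧ d₀ ≤ 4 ∧ ∃ k₀ : ℝ, 0 < k₀ ∧
      ∃ M₁ L₀ : ℕ, UniformThermo U δ d₀ k₀ M₁ L₀ := by
  rw [widthHaldaneBridge_iff] at h
  push Not at h
  obtain ⟨U, hU, δ, hδ, d₀, k₀, M₁, L₀, hd₀, hth, -⟩ := h
  refine ⟨U, hU, δ, hδ, d₀, hd₀, ?_, k₀, ?_, M₁, L₀, hth⟩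
  · by_contra hc
    exact uniformThermo_false_of_four_lt (not_le.mp hc) hth
  · by_contra hc
    exact uniformThermo_false_of_nonpos (not_lt.mp hc) hth

end Summit.HubbardSuperconductivity.HubbardSuperconductivity.Theorems.WidthHaldaneBridge.Negative

end
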